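import Summits.CriticalPhenomena.SAWScalingLimit.Theses.SAWSteinDefect
import Literature.Probability.RandomPlanarGeometry.LatticeSlitIncrements

/-!
# Birth skeleton (`Lines/birth.lean`) for crux `BalanceChannel` (stmt-CriticalPhenomena-7509)

Route `SAWSteinDefect` of `CriticalPhenomena/SAWScalingLimit`, crux r2 `BalanceChannel` — for every Dobrushin
domain `(D; a, b)`, hull subdomain `D'` (same marked points, agreeing with `D` near `a`, `b`) and endpoint
approximation, with `Q_n = 1[γ[0,n] ⊆ cl D'] · H'(γ[0,n]) / H(γ[0,n])` the LATTICE excursion-avoidance ratio of the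
past (`H`, `H'` the `4^{-|ω|}`-masses of nearest-neighbour walks of `Ω_δ` from the tip to `b_δ` avoiding the past,
resp. moreover staying in `cl D'`), the expected signed balance defect
`B(δ) = E_δ Σ_{n<N} f'(Q_n) [ΔQ_n − (3/16) ΔQ_n² / Q_n] → 0` as `δ → 0⁺` (`f(q) = q^{5/8}`, `f'(q) = (5/8)q^{-3/8}`).

## The line: STOPPED VALUE FUNCTION, READ TWICE — lattice value `Q` and continuum value `q̃` up to the first
low value; a-priori control after it (3 registered stubs)

Let `τ_θ = inf {n : Q_n < θ}` be the first step at which the lattice excursion-avoidance ratio of the past drops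
below the level `θ ∈ (0,1)` (`n < τ_θ ⟺ ∀ m ≤ n, θ ≤ Q_m`; a stopping time of the SAW filtration), and let
`q̃_n = 1[γ[0,n] ⊆ cl D'] · h_n'(ξ_n)` be the CONTINUUM value of the same past: the probability that a Brownian
excursion of `ℍ ∖ K_n` from the driving value `ξ_n` avoids the image of the obstacle `A = φ.pullbackHull D'`
(`LatticeSlit.avoidProb φ (γ.walk.take n) D'` of `LatticeSlitIncrements.lean`, [LSW03] Prop. 4.1 / §5, for a
chordal uniformizing map `φ : (ℍ; 0, ∞) → (D; a, b)`; dilation-invariant, so independent of the choice of `φ`).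
Write `B_θ` for the crux's sum restricted to `n < τ_θ` and `B̃_θ` for the same stopped sum with `Q` replaced by
`q̃` in the summand (the stopping rule stays the lattice one).  Then `B = (B − B_θ) + (B_θ − B̃_θ) + B̃_θ` and:

* `stub_lowValueLayer : LowValueLayer` (L; a-priori, inequality-type): for every `ε > 0` some level `θ ∈ (0,1)`
  makes `|B − B_θ| ≤ ε` eventually as `δ → 0⁺`.  Through the route's exact telescoping identity from `τ_θ` on
  (`Σ_{n ≥ τ} [f(Q_{n+1}) − f(Q_n)] = 1[avoid] − f(Q_τ)`), its content is: (i) LATE AVOIDANCE IS RARE — a SAW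
  whose past ever had excursion-avoidance ratio `< θ` seldom ends up avoiding `D ∖ D'`:
  `limsup_δ P_δ(avoid ∧ τ_θ < N) → 0` as `θ → 0` (one-sided shadow of optional stopping; for SLE_{8/3} exactly
  `≤ θ^{5/8}`); (ii) `f(Q_τ) < θ^{5/8}` by definition; (iii) the cubic Taylor remainder accumulated in the layer
  is small (tip regularity near `∂D'`; shares technology with the sibling crux `CubicRemainder`, stmt-7518).
* `stub_latticeToContinuum : LatticeToContinuum` (L/XL; discrete potential theory, no SLE): for every level
  `θ` and chordal uniformizing `φ`, `B_θ − B̃_θ → 0`.  Both stopped sums telescope at the SAME stopping time, so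
  the content is `E_δ[f(Q_{τ∧N}) − f(q̃_{τ∧N})] − [f(Q_0) − f(q̃_0)] → 0` (plus bulk cubic smallness of both):
  along SAW pasts in the bulk regime `Q ≥ θ` (and at the one crossing step), the random-walk excursion-avoidance
  ratio `H'/H` at the tip of the slit domain `Ω_δ ∖ γ[0,n]` equals the Brownian-excursion avoidance probability
  of the pulled-back slit hull up to `o(1)`, UNIFORMLY over the rough random slits a SAW produces — the
  uniform-in-the-past strengthening of the sibling crux `ExcursionInitialValue` (stmt-7519, which is the `n = 0`
  instance up to a continuum continuity) — discrete boundary Harnack at a slit tip (ratio of two discrete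
  harmonic functions killed on the same slit; microscopic tip-shape corrections are `O((δ/R)^{1/2})` relative).
* `stub_stoppedRestrictionLaw : StoppedRestrictionLaw` (XL, HARDEST — all the `κ = 8/3` / `α = 5/8` content):
  for every level `θ` and chordal uniformizing `φ`, `B̃_θ → 0`, i.e. (telescoping) `E_δ[q̃_{τ_θ∧N}^{5/8}] →
  Φ'_A(0)^{5/8}`: the LSW restriction martingale `M = h_t'(W_t)^{5/8}` of SLE_{8/3} ([LSW03] Prop. 5.2, Thm 6.1;
  `3/16 = 1/(2κ)`), evaluated along the lattice SAW, has the optional-stopping property at `τ_θ` asymptotically.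
  No lattice potential theory enters (the start value `q̃_0 → Φ'_A(0)` and the terminal value are continuum
  continuity statements); stopping in the bulk removes absorption jumps and tip regularity at the obstacle.
  Foreseen refinement (NOT filed; for tenure): in WINDOWED half-plane coordinates (mesoscopic capacity windows of
  `LatticeSlit.capTime`, increments `drivingIncrement`/`capIncrement`, weights `obstacleDeriv`) `B̃_θ` splits by
  the second-order expansion `Δq̃ ≈ h''Δξ + [h''²/(2h') − (4/3)h''']Δt + ½h'''Δξ²` of [LSW03] §5 into a windowed
  DRIFT channel `E Σ w h'' ΔΞ → 0` and a windowed `κ`-CHANNEL `E Σ w [h'''/2 − (3/16)h''²/h'](ΔΞ² − (8/3)ΔT) → 0`.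
  The PER-LATTICE-STEP version of that split (route header, TWO-LAYER PLAN) is an Itô–Stratonovich trap and is
  deliberately not filed: the per-step quadratic variation `Σ_n Δξ_n²` of a lattice driving function converges
  to `κ_micro · t` with a lattice-geometry constant `κ_micro ≠ 8/3` (zigzag energy; already a staircase
  approximation of a smooth curve has per-step `Σ Δξ² ≍ length > 0`), so the per-step `κ`-channel and drift
  channel pick up opposite `O(1)` corrections while their sum — and every statement filed here — is insensitive.
* PROVED glue (no `sorry`): `stoppedBalance_of` (`B_θ = (B_θ − B̃_θ) + B̃_θ → 0`, with `φ` from the tree theorem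
  `MarkedDomain.exists_isChordalUniformizing_holds`), `balanceChannel'_of` (the `ε/2` argument on `𝓝[>] 0`:
  `|B| ≤ |B − B_θ| + |B_θ|`), and `BalanceChannel_of` concluding the route decl BY NAME through
  `balanceChannel_iff : BalanceChannel' ↔ BalanceChannel := Iff.rfl` (the primed form is the crux with its three
  `let`s zeta-reduced into the §1 vocabulary, definitionally equal).

## Disproof / negatives used
* `Cruxes/BalanceChannel/Disproof.lean`: none exists (`ledger crux ls stmt-CriticalPhenomena-7509`: "no workfiles
  yet", 2026-08-17) — no `_false_without_` obstruction to honour, no landed `Theorems/BalanceChannel/Negative/*`.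
* `ledger negatives --problem CriticalPhenomena` (11 entries, 2026-08-17): the only SAW-law entry is stmt-0772
  (tightness over ALL `δ ∈ (0,1]`, refuted at `δ > 1/2`); avoided in kind — every stub is EVENTUAL in `δ`
  (`Tendsto … (𝓝[>] 0)` / `∀ᶠ δ in 𝓝[>] 0`). No other negative concerns excursion masses or the 5/8-law.
* Vacuity / junk pass: `Q_m`, `q̃_m` for `m ≥ N` are terminal values (`Walk.take`/`getVert` saturate), never used
  below `N`; `0 ^ (-3/8) = 0` and `x / 0 = 0` make post-absorption terms vanish in all three sums alike (the same
  lattice indicator `1[γ[0,n] ⊆ cl D']` guards `q̃`, so no junk value of `hydroFun` inside the obstacle hull is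
  ever read); SAW tips are lattice-accessible from `b_δ`, hence never swallowed by `Fill_ℍ` (no junk
  `drivingValue`); the stem of `z₀ = φ⁻¹(δ a_δ) → 0` is eventually disjoint from `A` (agreement near `a`); for
  `θ > Q_0` both stopped sums are `0` and `LowValueLayer` then asserts `|B| ≤ ε` — genuine content (small initial
  value ⇒ small avoidance AND small remainder), not vacuous; `θ` is chosen BEFORE `δ → 0⁺`, so the finite-`δ`
  coincidence `B_θ = B` for `θ` below the smallest positive `Q` of the finite system never trivialises it;
  `LatticeToContinuum`/`StoppedRestrictionLaw` are dilation-invariant in `φ` (`h'` is a probability, `ξ ↦ cξ`).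
-/

noncomputable section

open scoped BigOperators Topology Manifold Classical MeasureTheory ProbabilityTheory Matrix InnerProductSpace ComplexConjugate ContinuousMap ENNReal NNReal
open Filter Set Function TopologicalSpace MeasureTheory
open Literature.Probability.RandomPlanarGeometry Literature.Probability.LatticeModels

namespace Summit.CriticalPhenomena.SAWScalingLimit.Cruxes.BalanceChannel.Birth

/-! ### 1. Vocabulary (verbatim from the crux) -/

/-- The lattice EXCURSION MASS `H_δ(S; w)`: the `4^{-|ω|}`-mass of nearest-neighbour walks of `Ω_δ` from `w`
to `b_δ` that avoid the vertex list `S` after time `0` and stop at `b_δ`.  VERBATIM the crux's `let H`. -/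
def excMass (D : DobrushinDomain) (b : ℝ → Site 2) (δ : ℝ) (S : List (Site 2)) (w : Site 2) : ℝ :=
  ∑' ω : (discreteDomainGraph D.carrier δ).Walk w (b δ),
    if (∀ v ∈ ω.support.tail, v ∉ S) ∧ b δ ∉ ω.support.dropLast then (1 / 4 : ℝ) ^ ω.length else 0

/-- The RESTRICTED excursion mass `H'_δ(S; w)`: as `excMass`, the walks moreover staying in `closure D'`.
VERBATIM the crux's `let H'`. -/
def excMass' (D D' : DobrushinDomain) (b : ℝ → Site 2) (δ : ℝ) (S : List (Site 2)) (w : Site 2) : ℝ :=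
  ∑' ω : (discreteDomainGraph D.carrier δ).Walk w (b δ),
    if (∀ v ∈ ω.support.tail, v ∉ S) ∧ b δ ∉ ω.support.dropLast ∧
        Set.range (ω.toCurve (meshPoint δ)) ⊆ closure D'.carrier then (1 / 4 : ℝ) ^ ω.length else 0

/-- The lattice EXCURSION-AVOIDANCE RATIO `Q_n = 1[γ[0,n] ⊆ cl D'] · H'/H` of the past `γ[0,n]` of a SAW `γ`.
VERBATIM the crux's `let Q`. -/
def ratio (D D' : DobrushinDomain) (a b : ℝ → Site 2) (δ : ℝ)
    (γ : SAW.DomainSAW D.carrier δ (a δ) (b δ)) (n : ℕ) : ℝ :=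
  if Set.range ((γ.walk.take n).toCurve (meshPoint δ)) ⊆ closure D'.carrier then
    excMass' D D' b δ (γ.walk.take n).support (γ.walk.getVert n) /
      excMass D b δ (γ.walk.take n).support (γ.walk.getVert n)
  else 0

/-- The CONTINUUM VALUE `q̃_n = 1[γ[0,n] ⊆ cl D'] · h_n'(ξ_n)` of the same past: the Brownian-excursion avoidance
probability of the obstacle image seen from the driving value of the pulled-back slit hull
(`LatticeSlit.avoidProb`, [LSW03] Prop. 4.1 / §5), guarded by the same lattice indicator as `Q_n`. -/
def contValue (D D' : DobrushinDomain) (a b : ℝ → Site 2)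
    (φ : ConformalEquiv UpperHalfPlane.upperHalfPlaneSet D.carrier) (δ : ℝ)
    (γ : SAW.DomainSAW D.carrier δ (a δ) (b δ)) (n : ℕ) : ℝ :=
  if Set.range ((γ.walk.take n).toCurve (meshPoint δ)) ⊆ closure D'.carrier then
    LatticeSlit.avoidProb φ (γ.walk.take n) D'
  else 0

/-- The one-step BALANCE DEFECT `f'(q)[(q' − q) − (3/16)(q' − q)²/q]`, `f(q) = q^{5/8}`: VERBATIM the crux's
summand with `q = Q_n`, `q' = Q_{n+1}`. -/
def balanceTerm (q q' : ℝ) : ℝ :=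
  (5 / 8 : ℝ) * q ^ (-(3 : ℝ) / 8) * ((q' - q) - (3 / 16 : ℝ) * (q' - q) ^ 2 / q)

/-- The BALANCE SUM `B` along a SAW (the crux's integrand). -/
def balanceSum (D D' : DobrushinDomain) (a b : ℝ → Site 2) (δ : ℝ)
    (γ : SAW.DomainSAW D.carrier δ (a δ) (b δ)) : ℝ :=
  ∑ n ∈ Finset.range γ.length, balanceTerm (ratio D D' a b δ γ n) (ratio D D' a b δ γ (n + 1))

/-- The STOPPED balance sum `B_θ` at level `θ`: only the steps `n < τ_θ`, i.e. those with `Q_m ≥ θ` for all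
`m ≤ n` (the step INTO the low region is the last one counted). -/
def stoppedSum (D D' : DobrushinDomain) (a b : ℝ → Site 2) (θ : ℝ) (δ : ℝ)
    (γ : SAW.DomainSAW D.carrier δ (a δ) (b δ)) : ℝ :=
  ∑ n ∈ Finset.range γ.length,
    if ∀ m ≤ n, θ ≤ ratio D D' a b δ γ m then
      balanceTerm (ratio D D' a b δ γ n) (ratio D D' a b δ γ (n + 1)) else 0

/-- The CONTINUUM-READ stopped sum `B̃_θ`: the same steps (`n < τ_θ`, lattice stopping rule), the balance defect
of the continuum value `q̃` in place of `Q`. -/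
def contStoppedSum (D D' : DobrushinDomain) (a b : ℝ → Site 2)
    (φ : ConformalEquiv UpperHalfPlane.upperHalfPlaneSet D.carrier) (θ : ℝ) (δ : ℝ)
    (γ : SAW.DomainSAW D.carrier δ (a δ) (b δ)) : ℝ :=
  ∑ n ∈ Finset.range γ.length,
    if ∀ m ≤ n, θ ≤ ratio D D' a b δ γ m then
      balanceTerm (contValue D D' a b φ δ γ n) (contValue D D' a b φ δ γ (n + 1)) else 0

/-- The hull-subdomain hypotheses of the crux, bundled: `D' ⊆ D`, same marked points, agreement in balls
around `a` and `b`. (Used only in the stub statements; the primed crux keeps the arrows verbatim.) -/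
def IsHullSub (D D' : DobrushinDomain) : Prop :=
  D'.carrier ⊆ D.carrier ∧ D'.pt 0 = D.pt 0 ∧ D'.pt 1 = D.pt 1 ∧
    ∃ ε : ℝ, 0 < ε ∧ D'.carrier ∩ Metric.ball (D.pt 0) ε = D.carrier ∩ Metric.ball (D.pt 0) ε ∧
      D'.carrier ∩ Metric.ball (D.pt 1) ε = D.carrier ∩ Metric.ball (D.pt 1) ε

/-- STUB 1 statement — **low-value layer** (a priori): for every `ε > 0` some level `θ ∈ (0,1)` makes the layer
contribution `B(δ) − B_θ(δ)` at most `ε` in absolute value, eventually as `δ → 0⁺`. -/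
def LowValueLayer : Prop :=
  ∀ (D D' : DobrushinDomain) (a b : ℝ → Site 2), SAW.IsEndpointApprox D a b → IsHullSub D D' →
    ∀ ε : ℝ, 0 < ε → ∃ θ : ℝ, 0 < θ ∧ θ < 1 ∧
      ∀ᶠ δ : ℝ in 𝓝[>] 0,
        |(∫ γ, balanceSum D D' a b δ γ ∂(SAW.law D.carrier δ (a δ) (b δ))) -
            ∫ γ, stoppedSum D D' a b θ δ γ ∂(SAW.law D.carrier δ (a δ) (b δ))| ≤ ε

/-- STUB 2 statement — **lattice-to-continuum in the bulk**: for every level `θ ∈ (0,1)` and chordal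
uniformizing `φ`, the lattice-read and the continuum-read stopped sums have the same limit behaviour:
`B_θ(δ) − B̃_θ(δ) → 0` as `δ → 0⁺`. -/
def LatticeToContinuum : Prop :=
  ∀ (D D' : DobrushinDomain) (a b : ℝ → Site 2), SAW.IsEndpointApprox D a b → IsHullSub D D' →
    ∀ φ : ConformalEquiv UpperHalfPlane.upperHalfPlaneSet D.carrier, D.IsChordalUniformizing φ →
    ∀ θ : ℝ, 0 < θ → θ < 1 →
      Tendsto (fun δ => (∫ γ, stoppedSum D D' a b θ δ γ ∂(SAW.law D.carrier δ (a δ) (b δ))) -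
          ∫ γ, contStoppedSum D D' a b φ θ δ γ ∂(SAW.law D.carrier δ (a δ) (b δ)))
        (𝓝[>] 0) (𝓝 0)

/-- STUB 3 statement — **stopped restriction law** (the hardest): for every level `θ ∈ (0,1)` and chordal
uniformizing `φ`, the continuum-read stopped balance sum tends to `0`: optional stopping at `τ_θ` for the LSW
restriction martingale `q̃^{5/8}` along the SAW. -/
def StoppedRestrictionLaw : Prop :=
  ∀ (D D' : DobrushinDomain) (a b : ℝ → Site 2), SAW.IsEndpointApprox D a b → IsHullSub D D' →
    ∀ φ : ConformalEquiv UpperHalfPlane.upperHalfPlaneSet D.carrier, D.IsChordalUniformizing φ →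
    ∀ θ : ℝ, 0 < θ → θ < 1 →
      Tendsto (fun δ => ∫ γ, contStoppedSum D D' a b φ θ δ γ ∂(SAW.law D.carrier δ (a δ) (b δ)))
        (𝓝[>] 0) (𝓝 0)

/-- DERIVED (proved below from stubs 2 + 3): the **stopped balance law** for the lattice value — for every level
`θ ∈ (0,1)`, `B_θ(δ) → 0`. -/
def StoppedBalance : Prop :=
  ∀ (D D' : DobrushinDomain) (a b : ℝ → Site 2), SAW.IsEndpointApprox D a b → IsHullSub D D' →
    ∀ θ : ℝ, 0 < θ → θ < 1 →
      Tendsto (fun δ => ∫ γ, stoppedSum D D' a b θ δ γ ∂(SAW.law D.carrier δ (a δ) (b δ)))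
        (𝓝[>] 0) (𝓝 0)

/-- The crux with its three `let`s zeta-reduced into the §1 vocabulary (definitionally the route decl, see
`balanceChannel_iff`). -/
def BalanceChannel' : Prop :=
  ∀ (D D' : DobrushinDomain) (a b : ℝ → Site 2), SAW.IsEndpointApprox D a b → D'.carrier ⊆ D.carrier →
    D'.pt 0 = D.pt 0 → D'.pt 1 = D.pt 1 →
    (∃ ε : ℝ, 0 < ε ∧ D'.carrier ∩ Metric.ball (D.pt 0) ε = D.carrier ∩ Metric.ball (D.pt 0) ε ∧
      D'.carrier ∩ Metric.ball (D.pt 1) ε = D.carrier ∩ Metric.ball (D.pt 1) ε) →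
    Tendsto (fun δ => ∫ γ, balanceSum D D' a b δ γ ∂(SAW.law D.carrier δ (a δ) (b δ)))
      (𝓝[>] 0) (𝓝 0)

/-- The primed form IS the route decl: `BalanceChannel` unfolds (delta, then zeta on `H`, `H'`, `Q`, then delta
on the §1 vocabulary) to `BalanceChannel'`. -/
theorem balanceChannel_iff :
    BalanceChannel' ↔ Summit.CriticalPhenomena.SAWScalingLimit.Theses.SAWSteinDefect.BalanceChannel :=
  Iff.rfl

/-! ### 2. The registered stubs (the only `sorry`s of the file) -/

/-- STUB 1 (L): the low-value layer is negligible — late avoidance after a low value is rare, the stopping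
value is `< θ^{5/8}`, and the layer's cubic remainder is small, uniformly in small `δ`. -/
theorem stub_lowValueLayer : LowValueLayer := by
  sorry

/-- STUB 2 (L/XL): lattice-to-continuum in the bulk — along SAW pasts with `Q ≥ θ` the random-walk
excursion-avoidance ratio at the slit tip equals the Brownian-excursion avoidance probability of the pulled-back
slit hull up to `o(1)`, uniformly (discrete boundary Harnack at a slit tip), so `B_θ − B̃_θ → 0`. -/
theorem stub_latticeToContinuum : LatticeToContinuum := by
  sorry

/-- STUB 3 (XL, HARDEST): the stopped restriction law — optional stopping at `τ_θ` for the LSW restriction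
martingale `q̃^{5/8}` evaluated along the lattice SAW (`E_δ[q̃_{τ_θ∧N}^{5/8}] → Φ'_A(0)^{5/8}`), `B̃_θ → 0`. -/
theorem stub_stoppedRestrictionLaw : StoppedRestrictionLaw := by
  sorry

/-! ### Name-keyed aliases of the stub statements (hypotheses of the composition)

`Registered.stub_X : Prop` is the statement of `stub_X` under the registered stub's short name, so that the
skeleton audit (hypotheses admissible iff registered stubs BY NAME) accepts
`BalanceChannel_of : Registered.stub_… → … → BalanceChannel` (device of `Cruxes/ChainLaw/Lines/birth.lean`,
`Cruxes/BoundaryMixing/Lines/birth.lean`). -/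
namespace Registered

/-- Alias keyed by the registered stub name. -/
abbrev stub_lowValueLayer : Prop := LowValueLayer
/-- Alias keyed by the registered stub name. -/
abbrev stub_latticeToContinuum : Prop := LatticeToContinuum
/-- Alias keyed by the registered stub name. -/
abbrev stub_stoppedRestrictionLaw : Prop := StoppedRestrictionLaw

end Registered

/-! ### 3. The sorry-free part: the compositions -/

/-- **Layer 2 → layer 1 (no `sorry`)**: lattice-to-continuum and the stopped restriction law give the stopped
balance law for the lattice value, `B_θ = (B_θ − B̃_θ) + B̃_θ → 0 + 0`; the chordal uniformizing map is supplied
by the tree theorem `MarkedDomain.exists_isChordalUniformizing_holds` (Riemann + Carathéodory, proved). -/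
theorem stoppedBalance_of (h2 : LatticeToContinuum) (h3 : StoppedRestrictionLaw) : StoppedBalance := by
  intro D D' a b hab hH θ hθ0 hθ1
  obtain ⟨φ, hφ⟩ := MarkedDomain.exists_isChordalUniformizing_holds D
  have hsum := (h2 D D' a b hab hH φ hφ θ hθ0 hθ1).add (h3 D D' a b hab hH φ hφ θ hθ0 hθ1)
  rw [add_zero] at hsum
  refine hsum.congr' (Eventually.of_forall fun δ => ?_)
  simp only [sub_add_cancel]

/-- **Layer 1 → the crux, zeta-reduced form (no `sorry`)**: given `ε > 0`, the layer stub supplies a level `θ`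
with `|B − B_θ| ≤ ε/2` eventually, the stopped balance law at that `θ` gives `|B_θ| < ε/2` eventually, hence
`|B| < ε` eventually in `δ → 0⁺`. -/
theorem balanceChannel'_of (h0 : StoppedBalance) (h1 : LowValueLayer) : BalanceChannel' := by
  intro D D' a b hab hsub hpt0 hpt1 hball
  have hH : IsHullSub D D' := ⟨hsub, hpt0, hpt1, hball⟩
  rw [Metric.tendsto_nhds]
  intro ε hε
  obtain ⟨θ, hθ0, hθ1, hlayer⟩ := h1 D D' a b hab hH (ε / 2) (half_pos hε)
  have hbulk := h0 D D' a b hab hH θ hθ0 hθ1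
  rw [Metric.tendsto_nhds] at hbulk
  filter_upwards [hlayer, hbulk (ε / 2) (half_pos hε)] with δ hδ1 hδ2
  rw [Real.dist_0_eq_abs] at hδ2 ⊢
  calc |∫ γ, balanceSum D D' a b δ γ ∂(SAW.law D.carrier δ (a δ) (b δ))|
        = |((∫ γ, balanceSum D D' a b δ γ ∂(SAW.law D.carrier δ (a δ) (b δ))) -
              ∫ γ, stoppedSum D D' a b θ δ γ ∂(SAW.law D.carrier δ (a δ) (b δ))) +
            ∫ γ, stoppedSum D D' a b θ δ γ ∂(SAW.law D.carrier δ (a δ) (b δ))| := by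
          rw [sub_add_cancel]
    _ ≤ |(∫ γ, balanceSum D D' a b δ γ ∂(SAW.law D.carrier δ (a δ) (b δ))) -
              ∫ γ, stoppedSum D D' a b θ δ γ ∂(SAW.law D.carrier δ (a δ) (b δ))| +
            |∫ γ, stoppedSum D D' a b θ δ γ ∂(SAW.law D.carrier δ (a δ) (b δ))| := abs_add_le _ _
    _ < ε := by linarith

/-- **The composition (kernel-checked, no `sorry`)**: the three stubs imply the crux `BalanceChannel` BY NAME. -/
theorem BalanceChannel_of (h1 : Registered.stub_lowValueLayer) (h2 : Registered.stub_latticeToContinuum)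
    (h3 : Registered.stub_stoppedRestrictionLaw) :
    Summit.CriticalPhenomena.SAWScalingLimit.Theses.SAWSteinDefect.BalanceChannel :=
  balanceChannel_iff.mp (balanceChannel'_of (stoppedBalance_of h2 h3) h1)

/-- Wiring check: the registered stubs feed `BalanceChannel_of` as stated. -/
example : Summit.CriticalPhenomena.SAWScalingLimit.Theses.SAWSteinDefect.BalanceChannel :=
  BalanceChannel_of stub_lowValueLayer stub_latticeToContinuum stub_stoppedRestrictionLaw

end Summit.CriticalPhenomena.SAWScalingLimit.Cruxes.BalanceChannel.Birth

end
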